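import Literature.AlgebraicGeometry.Motives.FibreVerticalLines
import Literature.AlgebraicGeometry.Motives.LinesGenerateChowOneSumSq
import Literature.AlgebraicGeometry.Motives.WhiskerLeftPullback
import Mathlib.LinearAlgebra.LinearIndependent.BaseChange
import Literature.AlgebraicGeometry.Motives.LinearSubspacesGenerateChowProofs
import HarnessLib

/-!
# Vertical surfaces over curves of a two-dimensional base are line families over the normalized curve

Stage 1 ↦ Stage 2 transfer in the product-trick argument for `2`-cycles. Let `T` be an integral
`k`-scheme (a surface), `b ∈ T` a point of dimension `1` (the generic point of a curve `Γ ⊆ T`),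
`C = Γ^ν → T` the normalization of `Γ = closure {b}` (`curveB`, `curveν` of
`Motives/LinesGenerateChowOneSumSq`), `K = k(C)`. Then:

* `exists_ringEquiv_residueField_curveB` — `κ(b) ≅ k(C)` compatibly with `Spec k(C) → C → T`,
  `Spec κ(b) → T` and with the `k`-structures (the normalization is birational);
* `isPullback_ιX_whiskerLeft_curveν` — `X_K → X ×ₖ C → X ×ₖ T` is the base change of
  `Spec K → T` along `pr₂`, so every point of `X ×ₖ T` over `b` lifts to a point of the generic fibre
  `X_K` of `X ×ₖ C → C` (`exists_point_XK_curveB_of_snd_eq`), with the same push-forward to `X`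
  (`map_fst_primeCycle_eq_of_curveB`);
* `genericFibreι_whiskerLeft_eq_fibreSlice` — on `ℙᴺ`, the generic fibre of `ℙᴺ ×ₖ C` followed by
  `ℙᴺ ×ₖ C → ℙᴺ ×ₖ T` is the fibre slice `σ_b` of `Motives/FibreVerticalLines` (up to
  `ℙᴺ_K ≅ ℙᴺ_{κ(b)}`), so a point over the `κ(b)`-LINE point of the fibre lifts to a point of `X_K`
  over a `K`-line point (`isLinearSubspacePoint_iK_of_fibre_linePoint`).

Everything is proved; no definitions, no named facts. [folklore]

## References

* [TianZong2014] Z. Tian, H. R. Zong, *One-cycles on rationally connected varieties*, Compositio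
  Math. 150 (2014), proof of Prop. 7.2.
* [GortzWedhorn2020] U. Görtz, T. Wedhorn, *Algebraic Geometry I*, 2nd ed., Prop. 4.16, §(4.8).
* [Fulton1998] W. Fulton, *Intersection Theory*, §1.4, §1.7.
-/

noncomputable section

open CategoryTheory CategoryTheory.Limits AlgebraicGeometry MonoidalCategory MvPolynomial
  TopologicalSpace Order

universe u

namespace Literature.AlgebraicGeometry.Motives

attribute [local instance] MvPolynomial.gradedAlgebra MvPolynomial.algebraMvPolynomial
  Literature.AlgebraicGeometry.Motives.ProjBaseChange.algebraBase
  UniversalHyperplaneSection.sectionsAlgebra ProjFamily.functionFieldAlgebra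

namespace ProjFamily

open ProjBaseChangeRing ProjectiveSpaceCells

variable {k : Type u} [Field k]

/-! ### The residue field of `b` is the function field of the normalized curve -/

section ResidueField

variable (T : SchemeOver k) (b : T.left)

/-- The normalization `C = Γ^ν → T` sends the generic point of `C` to `b`. [folklore] -/
theorem curveν_genericPoint :
    (curveν T b).left.base (genericPoint (curveB T b).left) = b := by
  have h := curveA_apply T b (IsLocalRing.closedPoint (curveB T b).left.functionField)
  have hη : (qgen (curveB T b)).base (IsLocalRing.closedPoint (curveB T b).left.functionField) =
      genericPoint (curveB T b).left := by
    have h' : (qgen (curveB T b)).base (IsLocalRing.closedPoint _) ∈ Set.range (qgen (curveB T b)).base :=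
      ⟨_, rfl⟩
    rwa [range_qgen, Set.mem_singleton_iff] at h'
  rw [← hη]
  exact h

/-- **`κ(b) ≅ k(Γ^ν)` compatibly with the structure maps.** There is a ring isomorphism
`e : κ(ν(η_C)) ≃ k(C)` (`ν(η_C) = b`) such that `Spec k(C) → C → T` is
`Spec k(C) → Spec κ(ν η_C) → T` along `e`, and `e` intertwines the `k`-algebra structures
`k → Γ(T) → κ` and `k → Γ(C) → k(C)` (the normalization is birational and a `k`-morphism).
[folklore] -/
theorem exists_ringEquiv_residueField_curveB {b' : T.left}
    (hb' : (curveν T b).left.base (genericPoint (curveB T b).left) = b') :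
    ∃ e : T.left.residueField b' ≃+* (curveB T b).left.functionField,
      (curveB T b).left.fromSpecStalk (genericPoint (curveB T b).left) ≫ (curveν T b).left =
        Spec.map (CommRingCat.ofHom e.toRingHom) ≫ T.left.fromSpecResidueField b' ∧
      ∀ c : k, e (T.left.Γevaluation b' (T.hom.appTop ((Scheme.ΓSpecIso (.of k)).inv c))) =
        (curveB T b).left.presheaf.germ ⊤ (genericPoint (curveB T b).left) trivial
          ((curveB T b).hom.appTop ((Scheme.ΓSpecIso (.of k)).inv c)) := by
  subst hb'
  set C := curveB T b with hC
  set ν := curveν T b with hν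
  set η := genericPoint C.left with hη
  -- `r : k(C) → κ(η)` is bijective (`k(C)` is a field)
  let r : C.left.functionField →+* C.left.residueField η := (C.left.residue η).hom
  have hr : Function.Bijective r := ⟨r.injective, C.left.residue_surjective η⟩
  let rE : C.left.functionField ≃+* C.left.residueField η := RingEquiv.ofBijective r hr
  -- `e₀ : κ(ν η) → κ(η)` is bijective (birationality of the normalization)
  let e₀ : T.left.residueField (ν.left.base η) →+* C.left.residueField η := (ν.left.residueFieldMap η).hom
  have he₀ : Function.Bijective e₀ := ⟨e₀.injective, residueFieldMap_curveν_surjective (X := T) (z₀ := b)⟩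
  let e : T.left.residueField (ν.left.base η) ≃+* C.left.functionField :=
    (RingEquiv.ofBijective e₀ he₀).trans rE.symm
  refine ⟨e, ?_, fun c => ?_⟩
  · -- `fromSpecStalk η = Spec.map r⁻¹ ≫ fromSpecResidueField η`
    have h1 : C.left.fromSpecStalk η =
        Spec.map (CommRingCat.ofHom rE.symm.toRingHom) ≫ C.left.fromSpecResidueField η := by
      have hcomp : C.left.residue η ≫ CommRingCat.ofHom rE.symm.toRingHom = 𝟙 _ := by
        ext a
        change rE.symm (rE a) = a
        exact rE.symm_apply_apply a
      calc C.left.fromSpecStalk η = Spec.map (𝟙 _) ≫ C.left.fromSpecStalk η := by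
            rw [Spec.map_id, Category.id_comp]
        _ = Spec.map (C.left.residue η ≫ CommRingCat.ofHom rE.symm.toRingHom) ≫
              C.left.fromSpecStalk η :=
            congrArg (fun t => Spec.map t ≫ C.left.fromSpecStalk η) hcomp.symm
        _ = Spec.map (CommRingCat.ofHom rE.symm.toRingHom) ≫ C.left.fromSpecResidueField η := by
            rw [Spec.map_comp, Category.assoc]; rfl
    rw [h1, Category.assoc, ← Scheme.Hom.SpecMap_residueFieldMap_fromSpecResidueField,
      ← Category.assoc, ← Spec.map_comp]
    rfl
  · -- `e (ev_b (T.hom^* c)) = germ_η (C.hom^* c)`: in `κ(η)` this is the naturality of evaluation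
    set c' := (Scheme.ΓSpecIso (.of k)).inv c with hc'
    have happ : ν.left.appTop (T.hom.appTop c') = C.hom.appTop c' := by
      change ((T.hom.appTop ≫ ν.left.appTop) c') = _
      rw [← Scheme.Hom.comp_appTop, Over.w ν]
    have he0 : e₀ (T.left.Γevaluation _ (T.hom.appTop c')) =
        r (C.left.presheaf.germ ⊤ η trivial (C.hom.appTop c')) := by
      change ν.left.residueFieldMap η (T.left.Γevaluation (ν.left.base η) (T.hom.appTop c')) = _
      rw [Scheme.Γevaluation_naturality_apply, happ]
      rfl
    calc e (T.left.Γevaluation _ (T.hom.appTop c')) = rE.symm (e₀ (T.left.Γevaluation _ (T.hom.appTop c'))) := rfl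
      _ = rE.symm (rE (C.left.presheaf.germ ⊤ η trivial (C.hom.appTop c'))) := by rw [he0]; rfl
      _ = _ := rE.symm_apply_apply _

end ResidueField

/-! ### Points of `X ×ₖ T` over `b` lift to the generic fibre of `X ×ₖ Γ^ν → Γ^ν` -/

section Lift

variable (T : SchemeOver k) (b : T.left) (X : SchemeOver k)

/-- **`X_K → X ×ₖ Γ^ν → X ×ₖ T` is the base change of `Spec K → Γ^ν → T` along `pr₂`**
(`K = k(Γ^ν)`; paste the generic-fibre square of `X ×ₖ Γ^ν` with `X ×ₖ Γ^ν = (X ×ₖ T) ×_T Γ^ν`).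
[cite: GortzWedhorn2020, Prop. 4.16 (p. 101)] -/
theorem isPullback_ιX_whiskerLeft_curveν :
    IsPullback (ιX (curveB T b) X ≫ (X ◁ curveν T b).left) (pX (curveB T b) X)
      (CartesianMonoidalCategory.snd X T).left (qgen (curveB T b) ≫ (curveν T b).left) :=
  (isPullback_ιX (curveB T b) X).paste_horiz (isPullback_whiskerLeft_snd X (curveν T b))

/-- `X_K → X ×ₖ T` is a preimmersion (a base change of `Spec K → T`, which is `Spec κ(b) → T` up to
`K ≅ κ(b)`). [folklore] -/
theorem isPreimmersion_ιX_whiskerLeft_curveν :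
    IsPreimmersion (ιX (curveB T b) X ≫ (X ◁ curveν T b).left) := by
  obtain ⟨e, he, -⟩ := exists_ringEquiv_residueField_curveB T b rfl
  have hq : qgen (curveB T b) ≫ (curveν T b).left =
      Spec.map (CommRingCat.ofHom e.toRingHom) ≫ T.left.fromSpecResidueField _ := he
  haveI : IsPreimmersion (qgen (curveB T b) ≫ (curveν T b).left) := by
    rw [hq]
    haveI : IsIso (Spec.map (CommRingCat.ofHom e.toRingHom)) := by
      have : IsIso (CommRingCat.ofHom e.toRingHom) :=
        ⟨⟨CommRingCat.ofHom e.symm.toRingHom, by ext a; exact e.symm_apply_apply a,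
          by ext a; exact e.apply_symm_apply a⟩⟩
      infer_instance
    infer_instance
  exact MorphismProperty.of_isPullback (isPullback_ιX_whiskerLeft_curveν T b X).flip inferInstance

/-- **Every point of `X ×ₖ T` over `b` lifts to the generic fibre `X_K` of `X ×ₖ Γ^ν`.** [folklore] -/
theorem exists_point_XK_curveB_of_snd_eq {z : ↥(X ⊗ T).left}
    (hz : (CartesianMonoidalCategory.snd X T).left.base z = b) :
    ∃ x : ↥(XK (curveB T b) X),
      (ιX (curveB T b) X ≫ (X ◁ curveν T b).left).base x = z := by
  have H := isPullback_ιX_whiskerLeft_curveν T b X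
  let pt : ↥(Spec (curveB T b).left.functionField) := IsLocalRing.closedPoint _
  have hpt : (qgen (curveB T b) ≫ (curveν T b).left).base pt = b :=
    curveA_apply T b pt
  obtain ⟨w, hw, -⟩ := Scheme.Pullback.exists_preimage_pullback
    (f := (CartesianMonoidalCategory.snd X T).left) (g := qgen (curveB T b) ≫ (curveν T b).left)
    z pt (hz.trans hpt.symm)
  refine ⟨H.isoPullback.inv.base w, ?_⟩
  change ((H.isoPullback.inv ≫ (ιX (curveB T b) X ≫ (X ◁ curveν T b).left)).base w) = z
  rw [IsPullback.isoPullback_inv_fst]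
  exact hw

/-- **The lift has the same push-forward to `X`**: for `x ∈ X_K` lifting `z ∈ X ×ₖ T`,
`pr₁₊ [ι x] = pr₁₊ [z]` as cycles on `X` (`X_K → X ×ₖ T` is a preimmersion, so
`(X ×ₖ Γ^ν → X ×ₖ T)₊ [ι x] = [z]`; then functoriality of proper push-forward along
`X ×ₖ Γ^ν → X ×ₖ T → X`). [cite: Fulton1998, §1.4] -/
theorem map_fst_primeCycle_eq_of_curveB [IsProper T.hom] [IsProper X.hom]
    [QuasiCompact (CartesianMonoidalCategory.fst X T).left]
    [QuasiCompact (CartesianMonoidalCategory.fst X (curveB T b)).left] (x : ↥(XK (curveB T b) X)) :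
    AlgebraicCycle.map (CartesianMonoidalCategory.fst X T).left height height
        (primeCycle ((ιX (curveB T b) X ≫ (X ◁ curveν T b).left).base x)) =
      AlgebraicCycle.map (CartesianMonoidalCategory.fst X (curveB T b)).left height height
        (primeCycle ((ιX (curveB T b) X).base x)) := by
  set C := curveB T b with hC
  set ν := curveν T b with hν
  haveI : IsProper C.hom := isProper_curveB T b
  haveI : IsProper ν.left := by
    have h : ν.left ≫ T.hom = C.hom := Over.w ν
    haveI : IsProper (ν.left ≫ T.hom) := h ▸ inferInstance
    exact IsProper.of_comp ν.left T.hom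
  haveI : IsProper (X ◁ ν).left :=
    MorphismProperty.of_isPullback (isPullback_whiskerLeft_snd X ν).flip inferInstance
  haveI : IsProper (CartesianMonoidalCategory.fst X T).left :=
    inferInstanceAs (IsProper (pullback.fst X.hom T.hom))
  haveI : IsProper (CartesianMonoidalCategory.fst X C).left :=
    inferInstanceAs (IsProper (pullback.fst X.hom C.hom))
  haveI : LocallyOfFiniteType (X ⊗ T).hom :=
    inferInstanceAs (LocallyOfFiniteType (pullback.fst X.hom T.hom ≫ X.hom))
  haveI : LocallyOfFiniteType (X ⊗ C).hom :=
    inferInstanceAs (LocallyOfFiniteType (pullback.fst X.hom C.hom ≫ X.hom))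
  haveI : LocallyOfFiniteType ((X ◁ ν).left ≫ (X ⊗ T).hom) := by
    rw [Over.w (X ◁ ν)]; infer_instance
  -- `(X ×ₖ C → X ×ₖ T)₊ [ι x] = [z]`
  have hsurj : Function.Surjective (((X ◁ ν).left).residueFieldMap ((ιX C X).base x)) := by
    haveI := isPreimmersion_ιX_whiskerLeft_curveν T b X
    exact residueFieldMap_surjective_of_comp (ιX C X) (X ◁ ν).left x
      (residueFieldMap_surjective_of_isPreimmersion _ _)
  have h1 := algebraicCycleMap_primeCycle_of_residueFieldMap_surjective (X ◁ ν).left (X ⊗ T).hom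
    ((ιX C X).base x) hsurj
  -- functoriality
  have hcomp : (X ◁ ν).left ≫ (CartesianMonoidalCategory.fst X T).left =
      (CartesianMonoidalCategory.fst X C).left := by
    rw [← Over.comp_left, CartesianMonoidalCategory.whiskerLeft_fst]
  have h2 := algebraicCycleMap_comp (X ◁ ν).left (CartesianMonoidalCategory.fst X T).left
    (X ◁ ν).left.isClosedMap (CartesianMonoidalCategory.fst X T).left.isClosedMap
    (primeCycle ((ιX C X).base x))
  rw [h1] at h2
  change AlgebraicCycle.map (CartesianMonoidalCategory.fst X T).left height height
    (primeCycle (((X ◁ ν).left).base ((ιX C X).base x))) = _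
  rw [← h2]
  -- `map (φ ≫ fst_T) = map fst_C` along `φ ≫ fst_T = fst_C`
  have key : ∀ (g : (X ⊗ C).left ⟶ X.left) [QuasiCompact g], g = (CartesianMonoidalCategory.fst X C).left →
      AlgebraicCycle.map g height height (primeCycle ((ιX C X).base x)) =
        AlgebraicCycle.map (CartesianMonoidalCategory.fst X C).left height height
          (primeCycle ((ιX C X).base x)) := by
    intro g _ hg
    subst hg
    rfl
  exact key _ hcomp

end Lift

/-! ### The generic fibre of `ℙᴺ ×ₖ Γ^ν` over `b` is the fibre slice `σ_b` -/

section FibreSlice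

variable (N : ℕ) (T : SchemeOver k) (b : T.left) {U : T.left.Opens} (hU : IsAffineOpen U) (x : U)
  [Algebra Γ(T.left, U) (IsLocalRing.ResidueField (T.left.presheaf.stalk (x : T.left)))]
  [IsScalarTower Γ(T.left, U) (T.left.presheaf.stalk (x : T.left))
    (IsLocalRing.ResidueField (T.left.presheaf.stalk (x : T.left)))]
  [Algebra k (IsLocalRing.ResidueField (T.left.presheaf.stalk (x : T.left)))]
  [IsScalarTower k Γ(T.left, U) (IsLocalRing.ResidueField (T.left.presheaf.stalk (x : T.left)))]

/-- `map f (lin v) = lin (f ∘ v)`. [folklore] -/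
theorem map_lin {R S : Type u} [Field R] [Field S] (f : R →+* S) {N : ℕ} (v : Fin (N + 1) → R) :
    MvPolynomial.map f (lin v) = lin (f ∘ v) := by
  simp only [lin, map_sum, MvPolynomial.smul_eq_C_mul, map_mul, map_C, map_X, Function.comp_apply]

/-- **A point of `X ×ₖ T` over the `κ(b)`-line point of the fibre lifts to a point of `X_K` over a
`K`-line point** (`K = k(Γ^ν) ≅ κ(b)`). Precisely: let `e : κ(b) ≃ K` be compatible with
`Spec K → Γ^ν → T`, `Spec κ(b) → T` and the `k`-structures
(`exists_ringEquiv_residueField_curveB`), `z ∈ X ×ₖ T` with `(i × T)(z) = σ_b(λ♭)` for the generic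
point `λ♭` of the `κ(b)`-line `V₊(L♭)`, and `x' ∈ X_K` a lift of `z`
(`exists_point_XK_curveB_of_snd_eq`). Then `X_K → ℙᴺ_K` maps `x'` to a `K`-LINE point: the generic
fibre `ℙᴺ_K → ℙᴺ ×ₖ Γ^ν → ℙᴺ ×ₖ T` equals `ℙᴺ_K ≅ ℙᴺ_{κ(b)} → ℙᴺ ×ₖ T` (`σ_b`), by the universal
property of the product. [cite: GortzWedhorn2020, Prop. 4.16 (p. 101)] -/
theorem isLinearSubspacePoint_iK_of_fibre_linePoint (hN : 1 ≤ N)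
    (X : SchemeOver k) (i : X ⟶ projectiveSpace N k) [IsClosedImmersion i.left]
    (e : IsLocalRing.ResidueField (T.left.presheaf.stalk (x : T.left)) ≃+*
      (curveB T b).left.functionField)
    (hgen : (curveB T b).left.fromSpecStalk (genericPoint (curveB T b).left) ≫ (curveν T b).left =
      Spec.map (CommRingCat.ofHom e.toRingHom) ≫ T.left.fromSpecResidueField (x : T.left))
    (hek : ∀ c : k, e (algebraMap k _ c) = algebraMap k (curveB T b).left.functionField c)
    {Lb : Fin (N - 1) → MvPolynomial (Fin (N + 1))
      (IsLocalRing.ResidueField (T.left.presheaf.stalk (x : T.left)))}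
    (hLb : LinearIndependent (IsLocalRing.ResidueField (T.left.presheaf.stalk (x : T.left))) Lb)
    (hLbhom : ∀ l, (Lb l).IsHomogeneous 1)
    {z : ↥(X ⊗ T).left}
    (hz : (i ▷ T).left.base z =
      (Proj.map (mapGraded Γ(T.left, U)
        (IsLocalRing.ResidueField (T.left.presheaf.stalk (x : T.left))) (Fin (N + 1)))
        (irrelevant_le_map Γ(T.left, U)
          (IsLocalRing.ResidueField (T.left.presheaf.stalk (x : T.left))) (Fin (N + 1))) ≫
        openPiece N T hU).base (linearSubspacePoint Lb hLb hLbhom (Nat.sub_le N 1)))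
    {x' : ↥(XK (curveB T b) X)}
    (hx' : (ιX (curveB T b) X ≫ (X ◁ curveν T b).left).base x' = z) :
    IsLinearSubspacePoint 1 N (𝟙 (projectiveSpace N (curveB T b).left.functionField))
      ((iK N (curveB T b) X i).base x') := by
  classical
  set C := curveB T b with hC
  set ν := curveν T b with hν
  letI algκK : Algebra (IsLocalRing.ResidueField (T.left.presheaf.stalk (x : T.left))) C.left.functionField := e.toRingHom.toAlgebra
  haveI : IsScalarTower k (IsLocalRing.ResidueField (T.left.presheaf.stalk (x : T.left))) C.left.functionField := IsScalarTower.of_algebraMap_eq fun c => (hek c).symm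
  let E : (projectiveSpace N C.left.functionField).left ⟶ (projectiveSpace N (IsLocalRing.ResidueField (T.left.presheaf.stalk (x : T.left)))).left :=
    Proj.map (mapGraded (IsLocalRing.ResidueField (T.left.presheaf.stalk (x : T.left))) C.left.functionField (Fin (N + 1))) (irrelevant_le_map (IsLocalRing.ResidueField (T.left.presheaf.stalk (x : T.left))) C.left.functionField (Fin (N + 1)))
  let σ : (projectiveSpace N (IsLocalRing.ResidueField (T.left.presheaf.stalk (x : T.left)))).left ⟶ ((projectiveSpace N k) ⊗ T).left :=
    Proj.map (mapGraded Γ(T.left, U) (IsLocalRing.ResidueField (T.left.presheaf.stalk (x : T.left))) (Fin (N + 1))) (irrelevant_le_map Γ(T.left, U) (IsLocalRing.ResidueField (T.left.presheaf.stalk (x : T.left))) (Fin (N + 1))) ≫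
      openPiece N T hU
  -- (MI) the generic fibre of `ℙᴺ ×ₖ C` followed by `ℙᴺ ×ₖ C → ℙᴺ ×ₖ T` is `E ≫ σ`
  have hMI : genericFibreι N C ≫ ((projectiveSpace N k) ◁ ν).left = E ≫ σ := by
    have hfst : (genericFibreι N C ≫ ((projectiveSpace N k) ◁ ν).left) ≫
        (CartesianMonoidalCategory.fst (projectiveSpace N k) T).left =
          (E ≫ σ) ≫ (CartesianMonoidalCategory.fst (projectiveSpace N k) T).left := by
      rw [Category.assoc, ← Over.comp_left, CartesianMonoidalCategory.whiskerLeft_fst,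
        genericFibreι_fst, Category.assoc]
      rw [show σ ≫ (CartesianMonoidalCategory.fst (projectiveSpace N k) T).left =
        Proj.map (mapGraded k (IsLocalRing.ResidueField (T.left.presheaf.stalk (x : T.left))) (Fin (N + 1))) (irrelevant_le_map k (IsLocalRing.ResidueField (T.left.presheaf.stalk (x : T.left))) (Fin (N + 1))) from
          fibreSlice_fst N T hU x]
      have hcomp : Proj.map (mapGraded k C.left.functionField (Fin (N + 1))) (irrelevant_le_map k C.left.functionField (Fin (N + 1))) =
          Proj.map ((mapGraded (IsLocalRing.ResidueField (T.left.presheaf.stalk (x : T.left))) C.left.functionField (Fin (N + 1))).comp (mapGraded k (IsLocalRing.ResidueField (T.left.presheaf.stalk (x : T.left))) (Fin (N + 1))))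
            (HomogeneousIdeal.irrelevant_le_map_comp (irrelevant_le_map k (IsLocalRing.ResidueField (T.left.presheaf.stalk (x : T.left))) (Fin (N + 1)))
              (irrelevant_le_map (IsLocalRing.ResidueField (T.left.presheaf.stalk (x : T.left))) C.left.functionField (Fin (N + 1)))) := by
        congr 1
        ext p : 1
        change MvPolynomial.map (algebraMap k C.left.functionField) p =
          MvPolynomial.map (algebraMap (IsLocalRing.ResidueField (T.left.presheaf.stalk (x : T.left))) C.left.functionField) (MvPolynomial.map (algebraMap k (IsLocalRing.ResidueField (T.left.presheaf.stalk (x : T.left)))) p)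
        rw [MvPolynomial.map_map, ← IsScalarTower.algebraMap_eq]
      rw [hcomp]
      exact Proj.map_comp _ _ _ _
    have hsnd : (genericFibreι N C ≫ ((projectiveSpace N k) ◁ ν).left) ≫
        (CartesianMonoidalCategory.snd (projectiveSpace N k) T).left =
          (E ≫ σ) ≫ (CartesianMonoidalCategory.snd (projectiveSpace N k) T).left := by
      have l1 : ((projectiveSpace N k) ◁ ν).left ≫ (CartesianMonoidalCategory.snd (projectiveSpace N k) T).left =
          (CartesianMonoidalCategory.snd (projectiveSpace N k) C).left ≫ ν.left := by
        rw [← Over.comp_left, CartesianMonoidalCategory.whiskerLeft_snd, Over.comp_left]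
      have l2 : genericFibreι N C ≫ (CartesianMonoidalCategory.snd (projectiveSpace N k) C).left =
          (projToSpec (Fin (N + 1)) C.left.functionField ≫ qgen C : (projectiveSpace N C.left.functionField).left ⟶ C.left) :=
        genericFibreι_snd N C
      have r1 : σ ≫ (CartesianMonoidalCategory.snd (projectiveSpace N k) T).left =
          (projToSpec (Fin (N + 1)) (IsLocalRing.ResidueField (T.left.presheaf.stalk (x : T.left))) ≫ T.left.fromSpecResidueField (x : T.left) :
            (projectiveSpace N (IsLocalRing.ResidueField (T.left.presheaf.stalk (x : T.left)))).left ⟶ T.left) :=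
        (isPullback_fibreSlice N T hU x).w
      have r2 : E ≫ (projToSpec (Fin (N + 1)) (IsLocalRing.ResidueField (T.left.presheaf.stalk (x : T.left))) : (projectiveSpace N (IsLocalRing.ResidueField (T.left.presheaf.stalk (x : T.left)))).left ⟶ _) =
          (projToSpec (Fin (N + 1)) C.left.functionField ≫ Spec.map (CommRingCat.ofHom (algebraMap (IsLocalRing.ResidueField (T.left.presheaf.stalk (x : T.left))) C.left.functionField)) :
            (projectiveSpace N C.left.functionField).left ⟶ _) :=
        (isPullback_projMap' (IsLocalRing.ResidueField (T.left.presheaf.stalk (x : T.left))) C.left.functionField (n := N)).w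
      have hgen' : qgen C ≫ ν.left =
          Spec.map (CommRingCat.ofHom (algebraMap (IsLocalRing.ResidueField (T.left.presheaf.stalk (x : T.left))) C.left.functionField)) ≫ T.left.fromSpecResidueField (x : T.left) := hgen
      have hL : (genericFibreι N C ≫ ((projectiveSpace N k) ◁ ν).left) ≫
          (CartesianMonoidalCategory.snd (projectiveSpace N k) T).left =
            projToSpec (Fin (N + 1)) C.left.functionField ≫
              Spec.map (CommRingCat.ofHom (algebraMap
                (IsLocalRing.ResidueField (T.left.presheaf.stalk (x : T.left))) C.left.functionField)) ≫
                T.left.fromSpecResidueField (x : T.left) := by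
        rw [Category.assoc, l1, ← Category.assoc, l2, Category.assoc, hgen']
        rfl
      have hR : (E ≫ σ) ≫ (CartesianMonoidalCategory.snd (projectiveSpace N k) T).left =
            projToSpec (Fin (N + 1)) C.left.functionField ≫
              Spec.map (CommRingCat.ofHom (algebraMap
                (IsLocalRing.ResidueField (T.left.presheaf.stalk (x : T.left))) C.left.functionField)) ≫
                T.left.fromSpecResidueField (x : T.left) := by
        rw [Category.assoc, r1, ← Category.assoc, r2, Category.assoc]
        rfl
      exact hL.trans hR.symm
    exact pullback.hom_ext hfst hsnd
  -- `(i × T)(z) = σ (E (iK x'))`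
  have hexch : (ιX C X ≫ (X ◁ ν).left) ≫ (i ▷ T).left =
      (iK N C X i ≫ genericFibreι N C) ≫ ((projectiveSpace N k) ◁ ν).left := by
    rw [iK_genericFibreι, Category.assoc, Category.assoc, ← Over.comp_left, ← Over.comp_left,
      whisker_exchange]
  have hpt : (i ▷ T).left.base z = σ.base (E.base ((iK N C X i).base x')) := by
    rw [← hx']
    change (((ιX C X ≫ (X ◁ ν).left) ≫ (i ▷ T).left).base x') = _
    rw [hexch, Category.assoc, hMI]
    rfl
  -- `σ` is injective, so `E (iK x') = λ♭`
  haveI : IsPreimmersion (T.left.fromSpecResidueField (x : T.left)) := inferInstance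
  haveI hσ : IsPreimmersion σ :=
    MorphismProperty.of_isPullback (isPullback_fibreSlice N T hU x).flip
      (inferInstanceAs (IsPreimmersion (T.left.fromSpecResidueField (x : T.left))))
  have hEq : E.base ((iK N C X i).base x') = linearSubspacePoint Lb hLb hLbhom (Nat.sub_le N 1) :=
    σ.isEmbedding.injective (hpt.symm.trans hz)
  -- `E` is an isomorphism (`e` is), so heights agree
  letI algKκ : Algebra C.left.functionField (IsLocalRing.ResidueField (T.left.presheaf.stalk (x : T.left))) := e.symm.toRingHom.toAlgebra
  let E' : (projectiveSpace N (IsLocalRing.ResidueField (T.left.presheaf.stalk (x : T.left)))).left ⟶ (projectiveSpace N C.left.functionField).left :=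
    Proj.map (mapGraded C.left.functionField (IsLocalRing.ResidueField (T.left.presheaf.stalk (x : T.left))) (Fin (N + 1))) (irrelevant_le_map C.left.functionField (IsLocalRing.ResidueField (T.left.presheaf.stalk (x : T.left))) (Fin (N + 1)))
  have hEE' : E ≫ E' = 𝟙 _ := by
    have hcomp : E ≫ E' = Proj.map ((mapGraded (IsLocalRing.ResidueField (T.left.presheaf.stalk (x : T.left))) C.left.functionField (Fin (N + 1))).comp (mapGraded C.left.functionField (IsLocalRing.ResidueField (T.left.presheaf.stalk (x : T.left))) (Fin (N + 1))))
        (HomogeneousIdeal.irrelevant_le_map_comp (irrelevant_le_map C.left.functionField (IsLocalRing.ResidueField (T.left.presheaf.stalk (x : T.left))) (Fin (N + 1)))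
          (irrelevant_le_map (IsLocalRing.ResidueField (T.left.presheaf.stalk (x : T.left))) C.left.functionField (Fin (N + 1)))) := (Proj.map_comp _ _ _ _).symm
    rw [hcomp]
    refine projMap_eq_id_of_eq N _ (fun p => ?_) _
    change MvPolynomial.map (algebraMap (IsLocalRing.ResidueField (T.left.presheaf.stalk (x : T.left))) C.left.functionField) (MvPolynomial.map (algebraMap C.left.functionField (IsLocalRing.ResidueField (T.left.presheaf.stalk (x : T.left)))) p) = p
    rw [MvPolynomial.map_map]
    have hid : (algebraMap (IsLocalRing.ResidueField (T.left.presheaf.stalk (x : T.left))) C.left.functionField).comp (algebraMap C.left.functionField (IsLocalRing.ResidueField (T.left.presheaf.stalk (x : T.left)))) = RingHom.id C.left.functionField := by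
      ext a; exact e.apply_symm_apply a
    rw [hid, MvPolynomial.map_id]
  have hE'E : E' ≫ E = 𝟙 _ := by
    have hcomp : E' ≫ E = Proj.map ((mapGraded C.left.functionField (IsLocalRing.ResidueField (T.left.presheaf.stalk (x : T.left))) (Fin (N + 1))).comp (mapGraded (IsLocalRing.ResidueField (T.left.presheaf.stalk (x : T.left))) C.left.functionField (Fin (N + 1))))
        (HomogeneousIdeal.irrelevant_le_map_comp (irrelevant_le_map (IsLocalRing.ResidueField (T.left.presheaf.stalk (x : T.left))) C.left.functionField (Fin (N + 1)))
          (irrelevant_le_map C.left.functionField (IsLocalRing.ResidueField (T.left.presheaf.stalk (x : T.left))) (Fin (N + 1)))) := (Proj.map_comp _ _ _ _).symm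
    rw [hcomp]
    refine projMap_eq_id_of_eq N _ (fun p => ?_) _
    change MvPolynomial.map (algebraMap C.left.functionField (IsLocalRing.ResidueField (T.left.presheaf.stalk (x : T.left)))) (MvPolynomial.map (algebraMap (IsLocalRing.ResidueField (T.left.presheaf.stalk (x : T.left))) C.left.functionField) p) = p
    rw [MvPolynomial.map_map]
    have hid : (algebraMap C.left.functionField (IsLocalRing.ResidueField (T.left.presheaf.stalk (x : T.left)))).comp (algebraMap (IsLocalRing.ResidueField (T.left.presheaf.stalk (x : T.left))) C.left.functionField) = RingHom.id (IsLocalRing.ResidueField (T.left.presheaf.stalk (x : T.left))) := by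
      ext a; exact e.symm_apply_apply a
    rw [hid, MvPolynomial.map_id]
  haveI : IsIso E := ⟨⟨E', hEE', hE'E⟩⟩
  have hheight : height ((iK N C X i).base x') = 1 := by
    rw [← height_base_eq_of_isClosedImmersion' E, hEq, height_linearSubspacePoint,
      show N - (N - 1) = 1 by omega]
    rfl
  -- the `C.left.functionField`-forms `e(L♭)` vanish at `iK x'` and are independent
  let L' : Fin (N - 1) → MvPolynomial (Fin (N + 1)) C.left.functionField := fun l => MvPolynomial.map (algebraMap (IsLocalRing.ResidueField (T.left.presheaf.stalk (x : T.left))) C.left.functionField) (Lb l)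
  have hL'hom : ∀ l, (L' l).IsHomogeneous 1 := fun l => (hLbhom l).map _
  have hL'mem : ∀ l, L' l ∈ ProjectiveSpectrum.asHomogeneousIdeal
      (𝒜 := homogeneousSubmodule (Fin (N + 1)) C.left.functionField) ((iK N C X i).base x') := by
    intro l
    refine (ProjectiveSpectrum.mem_asHomogeneousIdeal_map_iff ((iK N C X i).base x') (Lb l)).1 ?_
    change Lb l ∈ ProjectiveSpectrum.asHomogeneousIdeal (𝒜 := homogeneousSubmodule (Fin (N + 1)) (IsLocalRing.ResidueField (T.left.presheaf.stalk (x : T.left))))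
      (E.base ((iK N C X i).base x'))
    rw [hEq]
    exact linearSubspacePoint_mem_zeroLocus Lb hLb hLbhom (Nat.sub_le N 1) ⟨l, rfl⟩
  have hL'li : LinearIndependent C.left.functionField L' := by
    -- through the coefficient vectors
    let v : Fin (N - 1) → Fin (N + 1) → (IsLocalRing.ResidueField (T.left.presheaf.stalk (x : T.left))) := fun l j => coeff (Finsupp.single j 1) (Lb l)
    have hv : ∀ l, lin (v l) = Lb l := fun l => (eq_lin_of_isHomogeneous_one (hLbhom l)).symm
    have hvli : LinearIndependent (IsLocalRing.ResidueField (T.left.presheaf.stalk (x : T.left))) v := by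
      refine LinearIndependent.of_comp (linMap (k := (IsLocalRing.ResidueField (T.left.presheaf.stalk (x : T.left)))) (N := N)) ?_
      have : ⇑(linMap (k := (IsLocalRing.ResidueField (T.left.presheaf.stalk (x : T.left)))) (N := N)) ∘ v = Lb := funext fun l => hv l
      rw [this]; exact hLb
    have hvK : LinearIndependent C.left.functionField fun l => (algebraMap (IsLocalRing.ResidueField (T.left.presheaf.stalk (x : T.left))) C.left.functionField) ∘ v l :=
      (linearIndependent_algebraMap_comp_iff (R := (IsLocalRing.ResidueField (T.left.presheaf.stalk (x : T.left)))) (S := C.left.functionField)).2 hvli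
    have hL'eq : L' = fun l => lin ((algebraMap (IsLocalRing.ResidueField (T.left.presheaf.stalk (x : T.left))) C.left.functionField) ∘ v l) := by
      funext l
      change MvPolynomial.map (algebraMap (IsLocalRing.ResidueField (T.left.presheaf.stalk (x : T.left))) C.left.functionField) (Lb l) = _
      rw [← hv l, map_lin]
    rw [hL'eq]
    exact hvK.map' (linMap (k := C.left.functionField) (N := N)) ker_linMap
  refine ⟨hheight, L', hL'li, hL'hom, ?_⟩
  -- `closure {iK x'} = V₊(L')` (image under `𝟙`)
  have hmem : (iK N C X i).base x' ∈ ProjectiveSpectrum.zeroLocus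
      (homogeneousSubmodule (Fin (N + 1)) C.left.functionField) (Set.range L') := by
    rintro _ ⟨l, rfl⟩; exact hL'mem l
  have hpeq : (iK N C X i).base x' = linearSubspacePoint L' hL'li hL'hom (Nat.sub_le N 1) := by
    by_contra hne
    have hlt := height_lt_of_mem_zeroLocus L' hL'li hL'hom (Nat.sub_le N 1) hmem hne
    rw [hheight, show N - (N - 1) = 1 by omega, Nat.cast_one] at hlt
    exact lt_irrefl _ hlt
  have hid : ⇑(𝟙 (projectiveSpace N C.left.functionField) : projectiveSpace N C.left.functionField ⟶ projectiveSpace N C.left.functionField).left.base = id := by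
    funext y; rfl
  rw [hid, Set.image_id, hpeq, closure_linearSubspacePoint]

end FibreSlice

end ProjFamily

end Literature.AlgebraicGeometry.Motives

end
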